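import Summits.ResolutionOfSingularities.ResolutionOfSingularities.Theorems.EquisingularLiftEquisingularLiftNatPointBlowupLocality
import Literature.AlgebraicGeometry.Resolution.AffineBlowup
import HarnessLib

/-!
# [OURS] LOCALITY OF THE TWO-STEP PROPERTY: «the blow-up at the point is regular over it UP TO FINITELY MANY CLOSED ONE-STEP POINTS» is local on the base
# (cruxes `Theses.EquisingularLift.EquisingularLiftNat` / `…NatThree`, stmt-ResolutionOfSingularities-20038 / -20148)

[OURS · leafhand-res-equisingularlift-10 g1, 2026-08-31; cell `pub/decomp-res`] AI-produced, weaker than expert review; NOT a statement of any manuscript;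
nothing here proves resolution of singularities in positive characteristic.  DEF-FREE helper; no `sorry`; standard axioms; ZERO named hypotheses.

Item (f) of lh10's repair census — «k-step points: generalise `chain_of_oneStepPoints` with a depth parameter; the locality brick is step-agnostic» — at
depth TWO (the depth of `A₃`, `A₄`, `D₄`: one point blow-up leaves finitely many `A₁` / `A₂` / `A₁` points).  A closed point `y` of `Γ` is TWO-STEP (spelled
inline, no definition) if for every blow-up `B → Γ` at the reduced point `y` there is a finite set `S' ⊆ B` of CLOSED ONE-STEP points over `y` off which `B` is
regular over `y` (a one-step point is two-step with `S' = ∅`).  This file proves that the two-step property, like the one-step property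
(✓ `PointChain.oneStepAt_of_isIso_morphismRestrict`, p829236), is LOCAL ON THE BASE:

* `PointChain.isIso_ι_morphismRestrict_self` — `W.ι ∣_ W` is an isomorphism (tree restriction criterion);
* ★ `PointChain.oneStepAt_of_open` / `PointChain.oneStepAt_to_open` — the one-step property passes from an open `W ∋ y` to `Γ` and back;
* ★ `PointChain.isClosed_singleton_of_preimage` — a point over a closed point, closed in the open preimage of an open neighbourhood, is closed;
* ★★★ `PointChain.twoStepAt_of_isIso_morphismRestrict` — **`ρ : Γ₂ → Γ` an isomorphism over an open `U ∋ y`, `y₂` over `y`: `y` two-step ⟹ `y₂` two-step**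
  (blow-ups of `Γ₂` at `y₂` and of `Γ` at `y` agree over `ρ⁻¹U ≅ U` up to isomorphism — ✓ `IsBlowup.restrict`, ✓ `IsBlowup.unique`; the finite set is carried
  through that isomorphism; closedness by `isClosed_singleton_of_preimage`, one-step-ness by the three one-step transports).

Next (separate file): `chain_of_twoStepPoints` — the downstairs induction on the number of two-step points, base case ✓ `chain_of_oneStepPoints`.
Honest label: closes no registered stub.

References: [GortzWedhorn2020, Prop. 13.91, (13.19)]; [StacksProject, Tags 080E, 02OS] — through the cited tree files.
-/

set_option linter.dupNamespace false -- mandated namespace `Summit.<Summit>.<Problem>` of this single-conjunct summit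

noncomputable section

open CategoryTheory CategoryTheory.Limits AlgebraicGeometry TopologicalSpace
open Literature.AlgebraicGeometry.Resolution
open AlgebraicGeometry.Scheme.IdealSheafData

namespace Summit.ResolutionOfSingularities.ResolutionOfSingularities.Cruxes.EquisingularLiftNat.Sections

namespace PointChain

universe u

/-! ## One-step: open ↔ ambient -/

/-- **`W.ι ∣_ W` is an isomorphism** (the inclusion of an open restricted over itself; tree restriction criterion with `j = 𝟙`). [folklore] -/
theorem isIso_ι_morphismRestrict_self {X : Scheme.{u}} (W : X.Opens) : IsIso (W.ι ∣_ W) := by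
  refine isIso_morphismRestrict_of_isOpenImmersion W.ι W (𝟙 _) ?_ ?_
  · rw [Scheme.Opens.ι_preimage_self]
    ext x
    simp only [Set.mem_range, TopologicalSpace.Opens.coe_top, Set.mem_univ, iff_true]
    exact ⟨x, rfl⟩
  · rw [Category.id_comp, Scheme.Opens.range_ι]

/-- ★ **One-step passes from an open to the ambient scheme**: if every blow-up of the open `W ∋ y` at its point `w₀` over the closed point `y` is regular over
`w₀`, then every blow-up of `Γ` at `y` is regular over `y` (restrict it over `W`: ✓ `IsBlowup.restrict`; stalks of an open subscheme). [folklore]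
[cite: GortzWedhorn2020, Prop. 13.91] -/
theorem oneStepAt_of_open {Γ : Scheme.{u}} (W : Γ.Opens) {y : Γ} (hyW : y ∈ W) (hy : IsClosed ({y} : Set Γ))
    (w₀ : (W : Scheme.{u})) (hw₀ : W.ι w₀ = y) (hw₀cl : IsClosed ({w₀} : Set (W : Scheme.{u})))
    (hone : ∀ (B : Scheme.{u}) (π : B ⟶ W), IsBlowup π (vanishingIdeal ⟨{w₀}, hw₀cl⟩) →
      ∀ b : B, π b = w₀ → IsRegularLocalRing (B.presheaf.stalk b)) :
    ∀ (Z : Scheme.{u}) (τ : Z ⟶ Γ), IsBlowup τ (vanishingIdeal ⟨{y}, hy⟩) →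
      ∀ z : Z, τ z = y → IsRegularLocalRing (Z.presheaf.stalk z) := by
  intro Z τ hτ z hz
  have hτW : IsBlowup (τ ∣_ W) (vanishingIdeal ⟨{w₀}, hw₀cl⟩) := by
    have h := hτ.restrict W
    rwa [comap_vanishingIdeal_singleton_openι W hy w₀ hw₀ hw₀cl] at h
  have hzW : z ∈ τ ⁻¹ᵁ W := by change τ z ∈ W; rw [hz]; exact hyW
  obtain ⟨zW, hzW'⟩ : ∃ zW : (τ ⁻¹ᵁ W : Scheme.{u}), (τ ⁻¹ᵁ W).ι zW = z := ⟨⟨z, hzW⟩, rfl⟩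
  have hτzW : (τ ∣_ W) zW = w₀ := by
    apply W.ι.isOpenEmbedding.injective
    rw [hw₀, ← Scheme.Hom.comp_apply, morphismRestrict_ι, Scheme.Hom.comp_apply, hzW', hz]
  haveI : IsRegularLocalRing ((τ ⁻¹ᵁ W : Scheme.{u}).presheaf.stalk zW) := hone _ (τ ∣_ W) hτW zW hτzW
  rw [← hzW']
  exact IsRegularLocalRing.of_ringEquiv (R := (τ ⁻¹ᵁ W : Scheme.{u}).presheaf.stalk zW)
    (asIso (((τ ⁻¹ᵁ W).ι).stalkMap zW)).commRingCatIsoToRingEquiv.symm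

/-- ★ **One-step passes from the ambient scheme to an open** `W ∋ y` (✓ `oneStepAt_of_isIso_morphismRestrict` for `W.ι`, an isomorphism over `W`). [folklore]
[cite: GortzWedhorn2020, Prop. 13.91] -/
theorem oneStepAt_to_open {Γ : Scheme.{u}} (W : Γ.Opens) {y : Γ} (hyW : y ∈ W) (hy : IsClosed ({y} : Set Γ))
    (hone : ∀ (B : Scheme.{u}) (π : B ⟶ Γ), IsBlowup π (vanishingIdeal ⟨{y}, hy⟩) →
      ∀ b : B, π b = y → IsRegularLocalRing (B.presheaf.stalk b))
    (w₀ : (W : Scheme.{u})) (hw₀ : W.ι w₀ = y) (hw₀cl : IsClosed ({w₀} : Set (W : Scheme.{u}))) :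
    ∀ (Z : Scheme.{u}) (τ : Z ⟶ W), IsBlowup τ (vanishingIdeal ⟨{w₀}, hw₀cl⟩) →
      ∀ z : Z, τ z = w₀ → IsRegularLocalRing (Z.presheaf.stalk z) := by
  haveI := isIso_ι_morphismRestrict_self W
  exact oneStepAt_of_isIso_morphismRestrict W.ι W hyW hy hone hw₀ hw₀cl

/-- ★ **Closedness from an open neighbourhood of the fibre**: `f x` a closed point lying in the open `W`; if the point of `f⁻¹W` over `x` is closed in `f⁻¹W`, then
`x` is closed in `X` (the closure of `{x}` lies over `f x`, hence inside `f⁻¹W`). [folklore] -/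
theorem isClosed_singleton_of_preimage {X Y : Scheme.{u}} (f : X ⟶ Y) (W : Y.Opens) {x : X} (hfx : IsClosed ({f x} : Set Y))
    (hxW : f x ∈ W) (xW : (f ⁻¹ᵁ W : Scheme.{u})) (hxW' : (f ⁻¹ᵁ W).ι xW = x)
    (hcl : IsClosed ({xW} : Set (f ⁻¹ᵁ W : Scheme.{u}))) : IsClosed ({x} : Set X) := by
  rw [← closure_subset_iff_isClosed]
  intro x' hx'
  have hfx' : f x' ∈ closure ({f x} : Set Y) := by
    have h := image_closure_subset_closure_image f.continuous (s := ({x} : Set X)) ⟨x', hx', rfl⟩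
    rwa [Set.image_singleton] at h
  rw [hfx.closure_eq, Set.mem_singleton_iff] at hfx'
  have hx'W : x' ∈ f ⁻¹ᵁ W := by change f x' ∈ W; rw [hfx']; exact hxW
  have key := (f ⁻¹ᵁ W).ι.isOpenEmbedding.isInducing.closure_eq_preimage_closure_image ({xW} : Set (f ⁻¹ᵁ W : Scheme.{u}))
  rw [hcl.closure_eq, Set.image_singleton, hxW'] at key
  have hmem : (⟨x', hx'W⟩ : (f ⁻¹ᵁ W : Scheme.{u})) ∈ (f ⁻¹ᵁ W).ι ⁻¹' closure ({x} : Set X) := hx'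
  rw [← key] at hmem
  have heq : (⟨x', hx'W⟩ : (f ⁻¹ᵁ W : Scheme.{u})) = xW := hmem
  have h := congrArg (fun w => (f ⁻¹ᵁ W).ι w) heq
  simp only [hxW'] at h
  exact h

/-! ## Two-step is local on the base -/

/-- ★★★ **THE TWO-STEP PROPERTY IS LOCAL ON THE BASE.**  `ρ : Γ₂ → Γ` an isomorphism over an open `U ∋ y` (`y` closed), `y₂` a closed point over `y`.  If for
every blow-up `B → Γ` at the reduced point `y` there is a finite set `S' ⊆ B` of closed ONE-STEP points over `y` such that `B` is regular at every other point over
`y`, then the same holds for every blow-up `Z → Γ₂` at `y₂`: over `ρ⁻¹U ≅ U` both are blow-ups of `U` at its point over `y`, unique up to isomorphism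
(✓ `IsBlowup.restrict`, ✓ `IsBlowup.unique`); the finite set is transported through that isomorphism, its points stay closed (`isClosed_singleton_of_preimage`) and
one-step (`oneStepAt_to_open`, ✓ `oneStepAt_of_iso`, `oneStepAt_of_open`). [OURS] [cite: GortzWedhorn2020, Prop. 13.91, (13.19)] -/
theorem twoStepAt_of_isIso_morphismRestrict {Γ Γ₂ : Scheme.{u}} (ρ : Γ₂ ⟶ Γ) (U : Γ.Opens) [IsIso (ρ ∣_ U)]
    {y : Γ} (hyU : y ∈ U) (hy : IsClosed ({y} : Set Γ))
    (htwo : ∀ (B : Scheme.{u}) (π : B ⟶ Γ), IsBlowup π (vanishingIdeal ⟨{y}, hy⟩) →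
      ∃ S' : Finset B, (∀ b : B, π b = y → b ∉ S' → IsRegularLocalRing (B.presheaf.stalk b)) ∧
        ∀ b ∈ S', π b = y ∧ ∃ hb : IsClosed ({b} : Set B), ∀ (B' : Scheme.{u}) (π' : B' ⟶ B),
          IsBlowup π' (vanishingIdeal ⟨{b}, hb⟩) → ∀ b' : B', π' b' = b → IsRegularLocalRing (B'.presheaf.stalk b'))
    {y₂ : Γ₂} (hy₂ : ρ y₂ = y) (hy₂cl : IsClosed ({y₂} : Set Γ₂)) :
    ∀ (Z : Scheme.{u}) (τ : Z ⟶ Γ₂), IsBlowup τ (vanishingIdeal ⟨{y₂}, hy₂cl⟩) →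
      ∃ S' : Finset Z, (∀ z : Z, τ z = y₂ → z ∉ S' → IsRegularLocalRing (Z.presheaf.stalk z)) ∧
        ∀ z ∈ S', τ z = y₂ ∧ ∃ hz : IsClosed ({z} : Set Z), ∀ (Z' : Scheme.{u}) (τ' : Z' ⟶ Z),
          IsBlowup τ' (vanishingIdeal ⟨{z}, hz⟩) → ∀ z' : Z', τ' z' = z → IsRegularLocalRing (Z'.presheaf.stalk z') := by
  classical
  intro Z τ hτ
  -- the open `V = ρ⁻¹ U ∋ y₂` and the isomorphism `e : V ≅ U`
  set V : Γ₂.Opens := ρ ⁻¹ᵁ U with hV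
  have hy₂V : y₂ ∈ V := by change ρ y₂ ∈ U; rw [hy₂]; exact hyU
  let e : (V : Scheme.{u}) ≅ (U : Scheme.{u}) := asIso (ρ ∣_ U)
  obtain ⟨u₀, hu₀⟩ : ∃ u₀ : (U : Scheme.{u}), U.ι u₀ = y := ⟨⟨y, hyU⟩, rfl⟩
  obtain ⟨v₀, hv₀⟩ : ∃ v₀ : (V : Scheme.{u}), V.ι v₀ = y₂ := ⟨⟨y₂, hy₂V⟩, rfl⟩
  have hu₀cl := isClosed_singleton_of_openι_eq U hy u₀ hu₀
  have hv₀cl := isClosed_singleton_of_openι_eq V hy₂cl v₀ hv₀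
  have hev : e.hom v₀ = u₀ := by
    apply U.ι.isOpenEmbedding.injective
    rw [hu₀, ← Scheme.Hom.comp_apply]
    change ((ρ ∣_ U) ≫ U.ι) v₀ = y; rw [morphismRestrict_ι, Scheme.Hom.comp_apply, hv₀, hy₂]
  -- `τ` restricted over `V`, then moved to `U`: a blow-up of `U` at `u₀`
  have hτV : IsBlowup (τ ∣_ V) (vanishingIdeal ⟨{v₀}, hv₀cl⟩) := by
    have h := hτ.restrict V
    rwa [comap_vanishingIdeal_singleton_openι V hy₂cl v₀ hv₀ hv₀cl] at h
  have hey : IsClosed ({e.hom v₀} : Set (U : Scheme.{u})) := by rw [hev]; exact hu₀cl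
  have hτU : IsBlowup (τ ∣_ V ≫ e.hom) (vanishingIdeal ⟨{e.hom v₀}, hey⟩) :=
    isBlowup_comp_iso_vanishingIdeal_singleton hv₀cl hτV e hey
  have hC : (⟨{e.hom v₀}, hey⟩ : Closeds (U : Scheme.{u})) = ⟨{u₀}, hu₀cl⟩ := Closeds.ext (by
    change ({e.hom v₀} : Set (U : Scheme.{u})) = {u₀}
    rw [hev])
  rw [hC] at hτU
  -- the reference blow-up `B → Γ` at `y`, restricted over `U`
  obtain ⟨B, πB, hπB⟩ : ∃ (B : Scheme.{u}) (πB : B ⟶ Γ), IsBlowup πB (vanishingIdeal ⟨{y}, hy⟩) :=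
    ⟨_, _, blowup.isBlowup (vanishingIdeal (⟨{y}, hy⟩ : Closeds Γ))⟩
  have hπBU : IsBlowup (πB ∣_ U) (vanishingIdeal ⟨{u₀}, hu₀cl⟩) := by
    have h := hπB.restrict U
    rwa [comap_vanishingIdeal_singleton_openι U hy u₀ hu₀ hu₀cl] at h
  -- uniqueness of blow-ups: `τ⁻¹ V ≅ πB⁻¹ U` over `U`
  obtain ⟨e₂, he₂, he₂'⟩ := hτU.unique hπBU
  -- the two-step datum of the reference blow-up
  obtain ⟨SB, hregB, hSB⟩ := htwo B πB hπB
  -- dictionary between points of `Z` over `y₂` and points of `B` over `y`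
  have hWB : ∀ b : B, πB b = y → b ∈ πB ⁻¹ᵁ U := fun b hb => by change πB b ∈ U; rw [hb]; exact hyU
  -- transport of a point `b ∈ SB` to `Z`
  let tr : {b // b ∈ SB} → Z := fun b => (τ ⁻¹ᵁ V).ι (e₂.inv ⟨b.1, hWB b.1 (hSB b.1 b.2).1⟩)
  let S' : Finset Z := SB.attach.image tr
  -- a point `z` over `y₂`: its avatar in `τ⁻¹ V` and its image `b` in `B`
  have havatar : ∀ z : Z, τ z = y₂ → ∃ zV : (τ ⁻¹ᵁ V : Scheme.{u}), (τ ⁻¹ᵁ V).ι zV = z ∧ (τ ∣_ V) zV = v₀ := by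
    intro z hz
    have hzV : z ∈ τ ⁻¹ᵁ V := by change τ z ∈ V; rw [hz]; exact hy₂V
    refine ⟨⟨z, hzV⟩, rfl, ?_⟩
    apply V.ι.isOpenEmbedding.injective
    rw [hv₀, ← Scheme.Hom.comp_apply, morphismRestrict_ι, Scheme.Hom.comp_apply]
    exact hz
  have hb_of : ∀ zV : (τ ⁻¹ᵁ V : Scheme.{u}), (τ ∣_ V) zV = v₀ → πB ((πB ⁻¹ᵁ U).ι (e₂.hom zV)) = y := by
    intro zV hzV
    rw [← Scheme.Hom.comp_apply, ← morphismRestrict_ι, Scheme.Hom.comp_apply, ← Scheme.Hom.comp_apply e₂.hom, he₂,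
      Scheme.Hom.comp_apply, hzV, hev, hu₀]
  refine ⟨S', fun z hz hzS => ?_, fun z hz => ?_⟩
  · -- (a) regular off `S'`
    obtain ⟨zV, hzV', hτzV⟩ := havatar z hz
    set b : B := (πB ⁻¹ᵁ U).ι (e₂.hom zV) with hbdef
    have hb : πB b = y := hb_of zV hτzV
    have hbSB : b ∉ SB := by
      intro hbSB
      apply hzS
      refine Finset.mem_image.mpr ⟨⟨b, hbSB⟩, Finset.mem_attach _ _, ?_⟩
      change (τ ⁻¹ᵁ V).ι (e₂.inv ⟨b, _⟩) = z
      have hbU : (⟨b, hWB b (hSB b hbSB).1⟩ : (πB ⁻¹ᵁ U : Scheme.{u})) = e₂.hom zV := by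
        apply (πB ⁻¹ᵁ U).ι.isOpenEmbedding.injective
        rw [Scheme.Opens.ι_apply, ← hbdef]
      rw [hbU]
      have hinv : e₂.inv (e₂.hom zV) = zV := by
        change (e₂.hom ≫ e₂.inv) zV = zV
        rw [e₂.hom_inv_id]; rfl
      rw [hinv]
      exact hzV'
    haveI hBreg : IsRegularLocalRing (B.presheaf.stalk b) := hregB b hb hbSB
    haveI : IsRegularLocalRing ((πB ⁻¹ᵁ U : Scheme.{u}).presheaf.stalk (e₂.hom zV)) :=
      IsRegularLocalRing.of_ringEquiv (R := B.presheaf.stalk b) (asIso (((πB ⁻¹ᵁ U).ι).stalkMap (e₂.hom zV))).commRingCatIsoToRingEquiv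
    haveI : IsRegularLocalRing ((τ ⁻¹ᵁ V : Scheme.{u}).presheaf.stalk zV) :=
      IsRegularLocalRing.of_ringEquiv (R := (πB ⁻¹ᵁ U : Scheme.{u}).presheaf.stalk (e₂.hom zV))
        (asIso (e₂.hom.stalkMap zV)).commRingCatIsoToRingEquiv
    rw [← hzV']
    exact IsRegularLocalRing.of_ringEquiv (R := (τ ⁻¹ᵁ V : Scheme.{u}).presheaf.stalk zV)
      (asIso (((τ ⁻¹ᵁ V).ι).stalkMap zV)).commRingCatIsoToRingEquiv.symm
  · -- (b) the points of `S'`: over `y₂`, closed, one-step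
    obtain ⟨b, -, rfl⟩ := Finset.mem_image.mp hz
    obtain ⟨hby, hbcl, honeb⟩ := hSB b.1 b.2
    set bU : (πB ⁻¹ᵁ U : Scheme.{u}) := ⟨b.1, hWB b.1 hby⟩ with hbUdef
    have hbU : (πB ⁻¹ᵁ U).ι bU = b.1 := rfl
    set zV : (τ ⁻¹ᵁ V : Scheme.{u}) := e₂.inv bU with hzVdef
    have hezV : e₂.hom zV = bU := by
      rw [hzVdef, ← Scheme.Hom.comp_apply, e₂.inv_hom_id]; rfl
    -- over `y₂`
    have hτzV : (τ ∣_ V) zV = v₀ := by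
      apply (Scheme.homeoOfIso e).injective
      change e.hom ((τ ∣_ V) zV) = e.hom v₀
      rw [hev, ← Scheme.Hom.comp_apply, ← he₂, Scheme.Hom.comp_apply, hezV]
      apply U.ι.isOpenEmbedding.injective
      rw [hu₀, ← Scheme.Hom.comp_apply, morphismRestrict_ι, Scheme.Hom.comp_apply, hbU, hby]
    have hτz : τ ((τ ⁻¹ᵁ V).ι zV) = y₂ := by
      rw [← Scheme.Hom.comp_apply, ← morphismRestrict_ι, Scheme.Hom.comp_apply, hτzV, hv₀]
    -- closed
    have hbUcl : IsClosed ({bU} : Set (πB ⁻¹ᵁ U : Scheme.{u})) := isClosed_singleton_of_openι_eq (πB ⁻¹ᵁ U) hbcl bU hbU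
    have hzVcl : IsClosed ({zV} : Set (τ ⁻¹ᵁ V : Scheme.{u})) :=
      isClosed_singleton_of_injective e₂.hom (Scheme.homeoOfIso e₂).injective (by rw [hezV]; exact hbUcl)
    have hzcl : IsClosed ({(τ ⁻¹ᵁ V).ι zV} : Set Z) :=
      isClosed_singleton_of_preimage τ V (by rw [hτz]; exact hy₂cl) (by rw [hτz]; exact hy₂V) zV rfl hzVcl
    refine ⟨hτz, hzcl, ?_⟩
    -- one-step: `b` in `B` ⟹ `bU` in `πB⁻¹U` ⟹ `zV` in `τ⁻¹V` ⟹ `z` in `Z`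
    have h1 : ∀ (B' : Scheme.{u}) (π' : B' ⟶ (πB ⁻¹ᵁ U : Scheme.{u})), IsBlowup π' (vanishingIdeal ⟨{bU}, hbUcl⟩) →
        ∀ b' : B', π' b' = bU → IsRegularLocalRing (B'.presheaf.stalk b') :=
      oneStepAt_to_open (πB ⁻¹ᵁ U) (hWB b.1 hby) hbcl honeb bU hbU hbUcl
    have hzVcl' : IsClosed ({e₂.symm.hom bU} : Set (τ ⁻¹ᵁ V : Scheme.{u})) := by
      change IsClosed ({e₂.inv bU} : Set _); exact hzVcl
    have h2 := oneStepAt_of_iso e₂.symm hbUcl h1 hzVcl'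
    have hC' : (⟨{e₂.symm.hom bU}, hzVcl'⟩ : Closeds (τ ⁻¹ᵁ V : Scheme.{u})) = ⟨{zV}, hzVcl⟩ := Closeds.ext rfl
    rw [hC'] at h2
    exact oneStepAt_of_open (τ ⁻¹ᵁ V) (show τ ((τ ⁻¹ᵁ V).ι zV) ∈ V by rw [hτz]; exact hy₂V) hzcl zV rfl hzVcl
      (fun B' π' hπ' b' hb' => h2 B' π' hπ' b' hb')

end PointChain

end Summit.ResolutionOfSingularities.ResolutionOfSingularities.Cruxes.EquisingularLiftNat.Sections

end
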